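import Summits.AtomisticToContinuum.Crystallization.Theses.FluxTubeKepler
import Summits.AtomisticToContinuum.Crystallization.Theorems.FluxTubeKeplerFluxCellKeplerCountTransfer
import Summits.AtomisticToContinuum.Crystallization.Theorems.FluxTubeKeplerFluxCellKeplerEnergyIdentity

/-!
# Strategist sketch — crux `FluxTubeKepler.FluxCellKepler` (stmt-AtomisticToContinuum-15221)

Lean appendix of `STRATEGY-CENSUS.md` (crux-strategist seat s1).  Every statement the census
discusses is typed here over existing declarations; the two compositions the census relies on are
PROVED (no `sorry` in this file):

* §1  the crux's own vocabulary (`LayeredGood`, `pat`, `Dom`, `cellScore`, `KeplerAt`);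
* §2  DECOMPOSITION lens — the single-scale split
      `X ⇐ (∃ P₀ R₁ τ, Dom ∧ KeplerAt 2) ∧ ChartGluing 2`, glue `fluxCellKepler_of_singleScale`
      proved from the landed counting lemma `FluxCellKeplerSketchCount.stub_badCountTransfer`;
* §3  STRENGTHEN lens — (a) the live line's `stub_coerciveFluxCells` IS the sharp local floor with
      a `θ`-margin (`localFloor_of_coercive`, proved from the tree floor `card_mul_eStar_le`);
      (b) the pointwise near/far form `PointwiseNearFar` (typed; shares the witness `τ`, which is
      why it cannot be cut into two stubs before `τ` is NAMED);
* §4  NEGATION lens — `ExactAtWitness`: any witness credit has zero over-credit density on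
      blocks of its own `P₀` (typed as a Prop; the arithmetic is in the census).
-/

noncomputable section

namespace Summit.AtomisticToContinuum.Crystallization.Cruxes.FluxCellKepler.Strategist

open scoped BigOperators
open Literature.MathematicalPhysics.StatisticalMechanics

/-- Euclidean 3-space. -/
abbrev E3 := EuclideanSpace ℝ (Fin 3)

/-! ## §1 Vocabulary (verbatim sub-expressions of the crux) -/

/-- The crux's defect predicate, verbatim: site `i` is `(R, η)`-layered-good. -/
def LayeredGood (R η : ℝ) {N : ℕ} (x : Fin N → E3) (i : Fin N) : Prop :=
  ∃ a : ℝ, 47 / 50 ≤ a ∧ a ≤ 1 ∧ ∃ (A : E3 →ₗᵢ[ℝ] E3) (s : ℤ → ℤ) (z : ℤ → ℝ), IsHaggSeq s ∧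
    (∀ m : ℤ, 39 / 50 * a ≤ z (m + 1) - z m ∧ z (m + 1) - z m ≤ 17 / 20 * a) ∧
    let S : Set E3 := {p | ∃ m k l : ℤ, p = A (((k : ℝ) • triangularVec₁ a) + ((l : ℝ) • triangularVec₂ a) + ((haggLabel s m : ℝ) • barlowOffset a) + (z m • layerNormal 1))};
    (∀ p ∈ S, ‖p‖ ≤ R → ∃ j : Fin N, dist (x j - x i) p ≤ η) ∧
      (∀ j : Fin N, ‖x j - x i‖ ≤ R → ∃ p ∈ S, dist (x j - x i) p ≤ η)

/-- The `R₁`-pattern of site `i` (the argument of `τ`). -/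
def pat (R₁ : ℝ) {N : ℕ} (x : Fin N → E3) (i : Fin N) : Finset E3 :=
  (Finset.univ.filter fun j : Fin N => dist (x j) (x i) ≤ R₁).image fun j => x j - x i

/-- `δ`-separation. -/
def IsSep (δ : ℝ) {N : ℕ} (x : Fin N → E3) : Prop := ∀ i j : Fin N, i ≠ j → δ ≤ dist (x i) (x j)

/-- (DOM). -/
def Dom (R₁ : ℝ) (τ : Finset E3 → ℝ) : Prop :=
  ∀ (N : ℕ) (x : Fin N → E3), Function.Injective x →
    ∑ i, siteEnergy (fun r => (r⁻¹) ^ 6) x i ≤ ∑ i, τ (pat R₁ x i)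

/-- The flux-cell score `λ_i = (1/24) site₁₂ − τ(pattern_i)/12`. -/
def cellScore (R₁ : ℝ) (τ : Finset E3 → ℝ) {N : ℕ} (x : Fin N → E3) (i : Fin N) : ℝ :=
  (1 / 24 : ℝ) * siteEnergy (fun r => (r⁻¹) ^ 12) x i - (1 / 12 : ℝ) * τ (pat R₁ x i)

/-- KEPLER at ONE pattern scale `R₀` (all `δ`, all `η`). -/
def KeplerAt (R₀ : ℝ) (P₀ : PeriodicConfiguration 3) (R₁ : ℝ) (τ : Finset E3 → ℝ) : Prop :=
  ∀ δ : ℝ, 0 < δ → ∀ η : ℝ, 0 < η → ∃ c : ℝ, 0 < c ∧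
    ∀ (N : ℕ) (x : Fin N → E3), Function.Injective x → IsSep δ x →
      c * (Nat.card {i : Fin N // ¬ LayeredGood R₀ η x i} : ℝ)
        ≤ ∑ i, cellScore R₁ τ x i - (N : ℝ) * P₀.energyPerParticle lennardJones

/-- KEPLER at every scale (the crux's second conjunct with `LayeredGood` folded). -/
def KeplerAll (P₀ : PeriodicConfiguration 3) (R₁ : ℝ) (τ : Finset E3 → ℝ) : Prop :=
  ∀ δ : ℝ, 0 < δ → ∀ R η : ℝ, 0 < R → 0 < η → ∃ c : ℝ, 0 < c ∧
    ∀ (N : ℕ) (x : Fin N → E3), Function.Injective x → IsSep δ x →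
      c * (Nat.card {i : Fin N // ¬ LayeredGood R η x i} : ℝ)
        ≤ ∑ i, cellScore R₁ τ x i - (N : ℝ) * P₀.energyPerParticle lennardJones

/-- Monotonicity of the predicate in the radius (same witnesses). [folklore] -/
theorem layeredGood_mono {R R' η : ℝ} (hR : R ≤ R') {N : ℕ} (x : Fin N → E3) (i : Fin N) :
    LayeredGood R' η x i → LayeredGood R η x i := by
  rintro ⟨a, ha₁, ha₂, A, s, z, hs, hz, h₁, h₂⟩
  refine ⟨a, ha₁, ha₂, A, s, z, hs, hz, ?_, ?_⟩
  · intro p hp hpR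
    exact h₁ p hp (hpR.trans hR)
  · intro j hj
    exact h₂ j (hj.trans hR)

/-! ## §2 DECOMPOSITION lens: the single-scale split (glue proved) -/

/-- **Chart gluing at pattern scale `R₀`** (`t`-controlled, potential-free): for every separation
`δ` and target scale `(R, η)` there are `η' > 0` and a radius `R'` such that a site all of whose
`R'`-neighbours are `(R₀, η')`-layered-good is `(R, η)`-layered-good.  For `R₀ = 2` this is the
hypothesis-trimmed form of the landed `FluxCellKeplerSketchGaps.good_of_clean` (whose proof uses
only the `LayeredNear` half of its hypothesis): compactness in the local matching topology +
`PrestressSplitKorn.exactLayeredRigidity_holds`.  Provable now (M). [folklore] -/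
def ChartGluing (R₀ : ℝ) : Prop :=
  ∀ δ : ℝ, 0 < δ → ∀ R η : ℝ, 0 < R → 0 < η → ∃ η' : ℝ, 0 < η' ∧ ∃ R' : ℝ,
    ∀ (N : ℕ) (x : Fin N → E3), IsSep δ x →
      ∀ i : Fin N, (∀ j : Fin N, dist (x j) (x i) ≤ R' → LayeredGood R₀ η' x j) →
        LayeredGood R η x i

/-- **Single-scale collapse (glue, proved).** KEPLER at one scale `R₀` plus chart gluing at `R₀`
give KEPLER at every scale: an `(R, η)`-bad site has an `(R₀, η')`-bad site within `max R' 0`,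
so `#bad_(R,η) ≤ (2 max R' 0/δ + 1)³ · #bad_(R₀,η')` by the landed packing count
`FluxCellKeplerSketchCount.stub_badCountTransfer`, and `c := c_(R₀)(η') / (2 max R' 0/δ + 1)³`.
[folklore] -/
theorem keplerAll_of_keplerAt {R₀ : ℝ} (hglue : ChartGluing R₀)
    (P₀ : PeriodicConfiguration 3) (R₁ : ℝ) (τ : Finset E3 → ℝ) (hK : KeplerAt R₀ P₀ R₁ τ) :
    KeplerAll P₀ R₁ τ := by
  intro δ hδ R η hR hη
  obtain ⟨η', hη', R', hG⟩ := hglue δ hδ R η hR hη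
  obtain ⟨c, hc, hcb⟩ := hK δ hδ η' hη'
  set ρ : ℝ := max R' 0 with hρ
  have hρ0 : 0 ≤ ρ := le_max_right _ _
  set M : ℝ := (2 * ρ / δ + 1) ^ 3 with hM
  have hM0 : 0 < M := by positivity
  refine ⟨c / M, div_pos hc hM0, fun N x hx hsep => ?_⟩
  -- every `(R, η)`-bad site has an `(R₀, η')`-bad site within `ρ`
  have hnear : ∀ i : Fin N, ¬ LayeredGood R η x i →
      ∃ j : Fin N, ¬ LayeredGood R₀ η' x j ∧ dist (x i) (x j) ≤ ρ := by
    intro i hi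
    by_contra hno
    push Not at hno
    refine hi (hG N x hsep i fun j hj => ?_)
    by_contra hbad
    have := hno j hbad
    rw [dist_comm] at hj
    linarith [le_max_left R' 0]
  have hcount :=
    Summit.AtomisticToContinuum.Crystallization.Theorems.FluxCellKeplerSketchCount.stub_badCountTransfer
      δ ρ hδ hρ0 N x (fun i => ¬ LayeredGood R η x i) (fun j => ¬ LayeredGood R₀ η' x j) hsep hnear
  have hkep := hcb N x hx hsep
  have h1 : c / M * (Nat.card {i : Fin N // ¬ LayeredGood R η x i} : ℝ)
      ≤ c * (Nat.card {j : Fin N // ¬ LayeredGood R₀ η' x j} : ℝ) := by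
    have := mul_le_mul_of_nonneg_left hcount (div_pos hc hM0).le
    calc c / M * (Nat.card {i : Fin N // ¬ LayeredGood R η x i} : ℝ)
        ≤ c / M * (M * (Nat.card {j : Fin N // ¬ LayeredGood R₀ η' x j} : ℝ)) := this
      _ = c * (Nat.card {j : Fin N // ¬ LayeredGood R₀ η' x j} : ℝ) := by
          field_simp
  exact h1.trans hkep

/-- **The single-scale split reaches the crux BY NAME (glue, proved).**
`(∃ P₀ R₁ τ, Dom R₁ τ ∧ KeplerAt R₀ P₀ R₁ τ) → ChartGluing R₀ → FluxCellKepler`. [folklore] -/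
theorem fluxCellKepler_of_singleScale {R₀ : ℝ}
    (h₁ : ∃ (P₀ : PeriodicConfiguration 3) (R₁ : ℝ) (τ : Finset E3 → ℝ),
      Dom R₁ τ ∧ KeplerAt R₀ P₀ R₁ τ)
    (h₂ : ChartGluing R₀) :
    Summit.AtomisticToContinuum.Crystallization.Theses.FluxTubeKepler.FluxCellKepler := by
  obtain ⟨P₀, R₁, τ, hdom, hkep⟩ := h₁
  have hall : KeplerAll P₀ R₁ τ := keplerAll_of_keplerAt h₂ P₀ R₁ τ hkep
  refine ⟨P₀, R₁, τ, hdom, ?_⟩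
  intro δ hδ R η hR hη
  obtain ⟨c, hc, hcb⟩ := hall δ hδ R η hR hη
  refine ⟨c, hc, ?_⟩
  intro N x hx hsep
  simpa [cellScore, pat, LayeredGood] using hcb N x hx hsep

/-- The two pieces of the single-scale split, as named propositions (the census's D3). -/
def SingleScaleKepler (R₀ : ℝ) : Prop :=
  ∃ (P₀ : PeriodicConfiguration 3) (R₁ : ℝ) (τ : Finset E3 → ℝ), Dom R₁ τ ∧ KeplerAt R₀ P₀ R₁ τ

/-- `SingleScaleKepler 2 → ChartGluing 2 → FluxCellKepler` (instance of the glue). [folklore] -/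
theorem fluxCellKepler_of_subs : SingleScaleKepler 2 → ChartGluing 2 →
    Summit.AtomisticToContinuum.Crystallization.Theses.FluxTubeKepler.FluxCellKepler :=
  fun h₁ h₂ => fluxCellKepler_of_singleScale h₁ h₂

/-! ## §3 STRENGTHEN lens

### (a) The live line's `stub_coerciveFluxCells` is the sharp LOCAL FLOOR with a `θ`-margin

`LocalFloor R₁ τ`: the cell-score sum is bounded below by the sharp crystal value `N · e*` on
every `δ`-separated configuration — the Lennard-Jones analogue of the Kepler bound (Flyspeck proved
the hard-sphere floor; the soft-potential floor with the sharp lattice-sum constant is open).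
`Coercive R₁ τ` (the body of the registered `stub_coerciveFluxCells`): over-credit
`Στ − Σ site₆ ≤ 12 θ (E − N e*)` with `θ < 1`.  Since `N e* ≤ E` is a tree theorem
(`ChargedEnergyGapNegative.card_mul_eStar_le`), `Coercive ⇒ LocalFloor`, and `LocalFloor` is the
case `θ = 1` of the same inequality: the live line's bet is exactly "the sharp local floor, with a
uniform fraction of the excess to spare". -/

/-- The periodic infimum `e*`. -/
def eStar : ℝ := ⨅ Q : PeriodicConfiguration 3, Q.energyPerParticle lennardJones

/-- The sharp local floor for a credit `(R₁, τ)`: `N e* ≤ Σ_i λ_i` on `δ`-separated `x`. -/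
def LocalFloor (R₁ : ℝ) (τ : Finset E3 → ℝ) : Prop :=
  ∀ δ : ℝ, 0 < δ → ∀ (N : ℕ) (x : Fin N → E3), Function.Injective x → IsSep δ x →
    (N : ℝ) * eStar ≤ ∑ i, cellScore R₁ τ x i

/-- Coercivity clause of the registered `stub_coerciveFluxCells` (verbatim body, `eStar` folded). -/
def Coercive (R₁ : ℝ) (τ : Finset E3 → ℝ) : Prop :=
  ∀ δ : ℝ, 0 < δ → ∃ θ : ℝ, θ < 1 ∧
    ∀ (N : ℕ) (x : Fin N → E3), Function.Injective x → IsSep δ x →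
      ∑ i, τ (pat R₁ x i) - ∑ i, siteEnergy (fun r => (r⁻¹) ^ 6) x i
        ≤ 12 * θ * (interactionEnergy lennardJones x - (N : ℝ) * eStar)

/-- The cell-score sum is the energy minus a twelfth of the over-credit. [folklore] -/
theorem sum_cellScore_eq (R₁ : ℝ) (τ : Finset E3 → ℝ) {N : ℕ} (x : Fin N → E3) :
    ∑ i, cellScore R₁ τ x i = interactionEnergy lennardJones x
      - (1 / 12 : ℝ) * (∑ i, τ (pat R₁ x i) - ∑ i, siteEnergy (fun r => (r⁻¹) ^ 6) x i) := by
  rw [Summit.AtomisticToContinuum.Crystallization.Theorems.FluxCellKeplerSketch.interactionEnergy_lennardJones_eq_sum]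
  simp only [cellScore, pat, Finset.sum_sub_distrib, ← Finset.mul_sum]
  ring

/-- **`Coercive ⇒ LocalFloor`** (so the live line's stub 3 contains the sharp local floor; it is
the case `θ < 1` of the floor inequality, whose case `θ = 1` is `LocalFloor`). [folklore] -/
theorem localFloor_of_coercive {R₁ : ℝ} {τ : Finset E3 → ℝ} (h : Coercive R₁ τ) :
    LocalFloor R₁ τ := by
  intro δ hδ N x hx hsep
  obtain ⟨θ, hθ, hθb⟩ := h δ hδ
  have hover := hθb N x hx hsep
  have hfloor : (N : ℝ) * eStar ≤ interactionEnergy lennardJones x :=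
    Summit.AtomisticToContinuum.Crystallization.Theorems.ChargedEnergyGapNegative.card_mul_eStar_le hx
  rw [sum_cellScore_eq]
  nlinarith [hover, hfloor, hθ]

/-- Conversely the floor is the `θ = 1` case: `LocalFloor R₁ τ` iff the over-credit is at most
`12 · (E − N e*)` on separated configurations. [folklore] -/
theorem localFloor_iff_overcredit (R₁ : ℝ) (τ : Finset E3 → ℝ) :
    LocalFloor R₁ τ ↔ ∀ δ : ℝ, 0 < δ → ∀ (N : ℕ) (x : Fin N → E3), Function.Injective x → IsSep δ x →
      ∑ i, τ (pat R₁ x i) - ∑ i, siteEnergy (fun r => (r⁻¹) ^ 6) x i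
        ≤ 12 * (interactionEnergy lennardJones x - (N : ℝ) * eStar) := by
  constructor
  · intro h δ hδ N x hx hsep
    have := h δ hδ N x hx hsep
    rw [sum_cellScore_eq] at this
    linarith
  · intro h δ hδ N x hx hsep
    have := h δ hδ N x hx hsep
    rw [sum_cellScore_eq]
    linarith

/-! ### (b) The pointwise near/far form (typed; ONE witness `τ, μ` shared by both regimes)

`S⁺`: a calibrated local score `μ` of range `R₂` (cell score plus zero-sum transfers, written as a
function of the `R₂`-pattern) with the envelope `Σ μ ≤ Σ λ`, the pointwise FLOOR `μ ≥ e(P₀)`, a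
NEAR-field margin `c(η)` at `(2, η)`-bad but `(2, η₁)`-good sites and a FAR-field margin `c₁` at
`(2, η₁)`-bad sites (`η₁ = 1/20`, the board's two-shell handover tolerance).  It implies
`KeplerAt 2` by the landed `FluxCellKeplerSketch.stub_keplerOfPointwise`.  The near and far
clauses constrain the SAME existential `μ` (and `τ`), so as long as the flux-cell credit is not a
NAMED object they cannot be registered as two stubs; with `τ` existential the whole of `S⁺` is one
statement at least as strong as `SingleScaleKepler 2`. -/

/-- Pointwise near/far certificate at pattern scale `2` with handover tolerance `η₁`. -/
def PointwiseNearFar (η₁ : ℝ) (P₀ : PeriodicConfiguration 3) (R₁ : ℝ) (τ : Finset E3 → ℝ) : Prop :=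
  ∃ (R₂ : ℝ) (μ : Finset E3 → ℝ), 2 ≤ R₂ ∧
    (∀ (N : ℕ) (x : Fin N → E3), Function.Injective x →
      ∑ i, μ (pat R₂ x i) ≤ ∑ i, cellScore R₁ τ x i) ∧
    (∀ δ : ℝ, 0 < δ →
      -- floor everywhere
      (∀ (N : ℕ) (x : Fin N → E3), Function.Injective x → IsSep δ x → ∀ i : Fin N,
        P₀.energyPerParticle lennardJones ≤ μ (pat R₂ x i)) ∧
      -- NEAR field: quadratic-type margin `c(η)` on good-but-strained sites
      (∀ η : ℝ, 0 < η → η ≤ η₁ → ∃ c : ℝ, 0 < c ∧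
        ∀ (N : ℕ) (x : Fin N → E3), Function.Injective x → IsSep δ x → ∀ i : Fin N,
          LayeredGood 2 η₁ x i → ¬ LayeredGood 2 η x i →
            P₀.energyPerParticle lennardJones + c ≤ μ (pat R₂ x i)) ∧
      -- FAR field: a gap `c₁` off the two-shell-layered stars
      (∃ c₁ : ℝ, 0 < c₁ ∧
        ∀ (N : ℕ) (x : Fin N → E3), Function.Injective x → IsSep δ x → ∀ i : Fin N,
          ¬ LayeredGood 2 η₁ x i → P₀.energyPerParticle lennardJones + c₁ ≤ μ (pat R₂ x i)))

/-! ## §4 NEGATION lens: exactness of the credit at its own witness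

Any witness `(P₀, R₁, τ)` of the crux has ZERO over-credit density on large blocks of `P₀`
(DOM gives `≥ 0`; KEPLER with `c ≥ 0` on the block and `E(block) = N e(P₀) + o(N)` give `≤ o(N)`).
Consequence recorded in the census: the `q = 0` flux-cell credit (the one all numerics so far
tested, and the one `FluxTubeBound` 15225 types) over-credits hcp by `σ_h > 0` (strict Thomson
inequality at a non-mirror-complete cell — Holmgren; item numerics `+1.0e-5` at res 12) and is
exact at fcc, while `e(hcp*) < e(fcc*)`: it can be the credit of NO Kepler witness. -/

/-- Zero over-credit density of `τ` along a family of finite configurations `y n` (e.g. the blocks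
of the witness `P₀`): `(Σ τ − Σ site₆)(y n) / #(y n) → 0`. -/
def ExactAlong (R₁ : ℝ) (τ : Finset E3 → ℝ) (n : ℕ → ℕ) (y : (k : ℕ) → (Fin (n k) → E3)) : Prop :=
  Filter.Tendsto (fun k => (∑ i, τ (pat R₁ (y k) i) - ∑ i, siteEnergy (fun r => (r⁻¹) ^ 6) (y k) i)
    / (n k : ℝ)) Filter.atTop (nhds 0)

end Summit.AtomisticToContinuum.Crystallization.Cruxes.FluxCellKepler.Strategist

end
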